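import Summits.HodgeConjecture.HodgeConjecture.Theorems.GenericDivisibilityGenericDivisibilityBoundedHeartOfHasDegree
import Summits.HodgeConjecture.HodgeConjecture.Theorems.GenericDivisibilityGenericDivisibilityBoundedHasDegreeOfSurjective
import Summits.HodgeConjecture.HodgeConjecture.Theorems.GenericDivisibilityGenericDivisibilityBoundedSmoothRoof
import Summits.HodgeConjecture.HodgeConjecture.Theorems.GenericDivisibilityGenericDivisibilityBoundedHeartBirationalUp
import Summits.HodgeConjecture.HodgeConjecture.Theorems.GenericDivisibilityGenericDivisibilityBoundedBirationalUp
import Summits.HodgeConjecture.HodgeConjecture.Theorems.GenericDivisibilityGenericDivisibilityBoundedSupportedTopBirationalUp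
import Summits.HodgeConjecture.HodgeConjecture.Theorems.GenericDivisibilityGenericDivisibilityBoundedSNCWitnessesUnconditional
import Literature.AlgebraicGeometry.HodgeTheory.ComplexOrientationDegreeOne
import HarnessLib

/-!
# Transport calculus of the heart of line `finite-level-bootstrap` (crux C2
# `GenericDivisibilityBounded`, stmt-HodgeConjecture-18467): every surjection, every projective model
# of the function field, SNC witnesses only

Lead c6 (cycle 8), assembly of the four registered sub-goals of this cycle (all landed:
`stub_heartOfHasDegree` p172282, `stub_levelCleanOfSNCWitnessesUnconditional` p172376,
`stub_hasDegreeNeZeroOfSurjective` p172973, `stub_smoothRoofOfProjModels` p173027). Sorry-free,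
definition-free. Notation as in the sibling files, spelled inline: `X`, `X'` smooth projective over `ℂ`
of dimension `n`, `z| = z|_{(X∖Z)(ℂ)}`; "`x ∈ GT(X)`": `∃ Z` closed `≠ univ`, `∃ N ≥ 1`, `N • x| = 0`;
"`D'(m, z)`": `∃ Z` closed `≠ univ`, `∃ y`, `∃ M ≥ 1`, `M • (z| - m • y) = 0`; "level `ℓ^s` is CLEAN at `X`
in degree `k`": `∀ z, D'(ℓ^s, z) → ∃ w, z - ℓ • w ∈ GT(X)`; the HEART of the line at the prime `ℓ` and the
variety `X` (degree `k = 2p = dim X`): `∃ s ≥ 1`, level `ℓ^s` clean; "C2 at `X` in degree `k`": every `z`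
divisible by every `m ≥ 1` on non-empty Zariski opens has `z ⊗ 1 ∈ N¹Hᵏ(X(ℂ);ℂ)`.

## Main results

* `genericDivisibilityBounded_exists_eq_prime_pow_mul_coprime` — a non-zero integer is `ℓ^v d'` with
  `gcd(ℓ, d') = 1` (`ℓ` prime).
* `genericDivisibilityBounded_heart_of_surjective` — **the heart at `ℓ` DESCENDS along EVERY surjective
  morphism `f : X' ⟶ X` of smooth projective `n`-folds** (degree `k ≥ 1`, `k + q = 2n`): the degree of
  `f(ℂ)` for the complex integral orientations is a non-zero integer `d = ℓ^v d'`
  (`genericDivisibilityBounded_exists_hasDegree_ne_zero_of_surjective`), and a clean level `ℓ^s` at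
  `X'` gives the clean level `ℓ^(v+s)` at `X` (`genericDivisibilityBounded_levelClean_of_hasDegree_pow`:
  bootstrap, integral Gysin push-forward, saturation of `GT`, Bézout). No coprimality and no degree
  datum are needed any more (compare `stub_heartOfHasDegreeCoprime`, p162684).
* `genericDivisibilityBounded_heart_of_span` — hence along spans `X ⟵σ X'' ⟶g Y`, `σ` birational,
  `g` onto (with the birational invariance `genericDivisibilityBounded_levelClean_iff_of_isBirational`,
  p167622): finite quotients by ANY finite group, generically finite dominant rational maps.
* `genericDivisibilityBounded_levelClean_iff_of_projModels`,
  `genericDivisibilityBounded_at_iff_of_projModels`,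
  `genericDivisibilityBounded_supportedClasses_eq_top_iff_of_projModels` — **the clean level `ℓ^s`
  (hence the heart), C2 at `X`, and the `N¹ = ⊤` locus are invariants of the FUNCTION FIELD**: for two
  projective models `M₁`, `M₂` of one field `K/ℂ` (`Resolution.ProjModel ℂ K`) whose varieties are smooth
  projective `n`-folds the three properties agree (common smooth projective birational roof
  `stub_smoothRoofOfProjModels` — join of models, Zariski–Samuel VI §17, resolved by the tree's proved
  projective Hironaka — and the two-sided birational invariance of each property, p160936/p162489,
  p162684/p167622, p161788/p167882).
* `genericDivisibilityBounded_levelClean_iff_SNCWitnesses` — **the SNC normal form of the heart as an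
  equivalence, unconditionally**: level `ℓ^s` is clean at the smooth projective `2p`-fold `X` iff the
  clean-level conclusion holds for the classes `z'` with `D'_{⋃ supp E}(ℓ^s, z')` on every smooth
  projective birational model `X' ⟶ X` and every simple-normal-crossing boundary `E` on `X'` with
  `⋃ supp E ≠ X'` (←: log resolution of the witness, the tree's proved
  `Resolution.exists_logResolution_isSmoothProjective_hasSNC`, p172376; →: birational invariance and
  closedness of `⋃ supp E`).

So the heart `stub_finiteLevel` — the one open stub of the line — is a statement about finitely
generated fields of transcendence degree `2p` over `ℂ`, closed under passing to the target of any
surjection of smooth projective models, and decided on complements of SNC divisors.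

References: [FultonYoungTableaux1997] App. B §B.1 (5)–(7); [HatcherAT2002] §3.3 Thm. 3.26;
[VoisinHodgeI2002] §7.3.2 Lemma 7.28; [ZariskiSamuel1960] Ch. VI §17; [Kollar2007] Thm. 3.21, 3.27;
[ColliotTheleneVoisin2012] Thm. 2.8 (iii), Prop. 3.4 (birational invariance of unramified cohomology —
the method).
-/

set_option linter.dupNamespace false

noncomputable section

namespace Summit.HodgeConjecture.HodgeConjecture.Theorems

open CategoryTheory AlgebraicGeometry
open Literature.AlgebraicGeometry.Motives Literature.AlgebraicGeometry.HodgeTheory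
  Literature.AlgebraicTopology.SingularHomology

/-- Restriction `H^k(X(ℂ);ℤ) → H^k((X∖Z)(ℂ);ℤ)`, the very term of the route decls (notation only). -/
local notation3 (prettyPrint := false) "Res[" X ", " Z ", " k "]" =>
  singularCohomology.map ℤ ℤ
    (⟨Subtype.val, continuous_subtype_val⟩ : C(complexPointsCompl X Z, ComplexPoints X)) k

/-! ### Arithmetic -/

/-- A non-zero integer is `ℓ^v d'` with `gcd(ℓ, d') = 1`, for `ℓ` prime (finite multiplicity of the
prime `ℓ` in `d ≠ 0`). [folklore] -/
theorem genericDivisibilityBounded_exists_eq_prime_pow_mul_coprime {ℓ : ℕ} (hℓ : ℓ.Prime) {d : ℤ}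
    (hd : d ≠ 0) : ∃ (v : ℕ) (d' : ℤ), IsCoprime (ℓ : ℤ) d' ∧ d = (ℓ : ℤ) ^ v * d' := by
  have hprime : Prime (ℓ : ℤ) := Nat.prime_iff_prime_int.1 hℓ
  obtain ⟨c, hc, hndvd⟩ := (FiniteMultiplicity.of_prime_left hprime hd).exists_eq_pow_mul_and_not_dvd
  exact ⟨multiplicity (ℓ : ℤ) d, c, (Irreducible.coprime_iff_not_dvd hprime.irreducible).2 hndvd, hc⟩

/-! ### The heart descends along every surjection -/

/-- **The heart at the prime `ℓ` DESCENDS along every surjective morphism of smooth projective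
`n`-folds.** For `f : X' ⟶ X` onto on points between smooth projective `n`-folds, `k + q = 2n`,
`k ≥ 1`, `ℓ` prime: if some level `ℓ^s` (`s ≥ 1`) is clean at `X'` in degree `k` then some level is
clean at `X` in degree `k`. Proof: the degree of `f(ℂ)` for the complex integral orientations is a
non-zero integer (`genericDivisibilityBounded_exists_hasDegree_ne_zero_of_surjective`: Hatcher
Thm. 3.26 and Voisin I Lemma 7.28), write it `ℓ^v d'` with `gcd(ℓ, d') = 1`; then level `ℓ^(v+s)` is
clean at `X` (`genericDivisibilityBounded_levelClean_of_hasDegree_pow`: pull back, bootstrap at `X'`,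
integral Gysin push-forward `f_! f^* = ℓ^v d'`, saturation of `GT`, Bézout).
[cite: FultonYoungTableaux1997, Appendix B §B.1 (5)–(7)] [cite: HatcherAT2002, §3.3 Thm. 3.26]
[cite: VoisinHodgeI2002, §7.3.2 Lemma 7.28] -/
theorem genericDivisibilityBounded_heart_of_surjective {n : ℕ} {X' X : SchemeOver ℂ} (f : X' ⟶ X)
    (hX' : IsSmoothProjective n X') (hX : IsSmoothProjective n X)
    (hf : Function.Surjective f.left.base) {k q : ℕ} (hkq : k + q = 2 * n) (hk : 1 ≤ k) {ℓ : ℕ}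
    (hℓ : ℓ.Prime)
    (hC : ∃ s : ℕ, 1 ≤ s ∧ ∀ z' : singularCohomology ℤ ℤ (ComplexPoints X') k,
      (∃ Z : Set X'.left, IsClosed Z ∧ Z ≠ Set.univ ∧
        ∃ (y : singularCohomology ℤ ℤ (complexPointsCompl X' Z) k) (M : ℕ), 1 ≤ M ∧
          M • (Res[X', Z, k] z' - ℓ ^ s • y) = 0) →
      ∃ w : singularCohomology ℤ ℤ (ComplexPoints X') k, ∃ Z : Set X'.left, IsClosed Z ∧
        Z ≠ Set.univ ∧ ∃ N : ℕ, 1 ≤ N ∧ N • Res[X', Z, k] (z' - ℓ • w) = 0) :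
    ∃ s : ℕ, 1 ≤ s ∧ ∀ z : singularCohomology ℤ ℤ (ComplexPoints X) k,
      (∃ Z : Set X.left, IsClosed Z ∧ Z ≠ Set.univ ∧
        ∃ (y : singularCohomology ℤ ℤ (complexPointsCompl X Z) k) (M : ℕ), 1 ≤ M ∧
          M • (Res[X, Z, k] z - ℓ ^ s • y) = 0) →
      ∃ w : singularCohomology ℤ ℤ (ComplexPoints X) k, ∃ Z : Set X.left, IsClosed Z ∧
        Z ≠ Set.univ ∧ ∃ N : ℕ, 1 ≤ N ∧ N • Res[X, Z, k] (z - ℓ • w) = 0 := by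
  letI := hX'.chartedSpace
  letI := hX.chartedSpace
  haveI := ComplexPoints.t2Space_of_isSmoothProjective hX'
  haveI := ComplexPoints.t2Space_of_isSmoothProjective hX
  obtain ⟨d, hd, hdeg⟩ := genericDivisibilityBounded_exists_hasDegree_ne_zero_of_surjective f hX' hX
    (complexOrientationInt hX') (complexOrientationInt hX) hf
  obtain ⟨v, d', hcop, rfl⟩ := genericDivisibilityBounded_exists_eq_prime_pow_mul_coprime hℓ hd
  obtain ⟨s, hs, hC⟩ := hC
  exact ⟨v + s, by omega, fun z hz ↦ genericDivisibilityBounded_levelClean_of_hasDegree_pow f hX' hX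
    _ _ hdeg hf hkq hk hℓ.one_lt.le hcop s hC z hz⟩

/-- **The heart at `ℓ` passes along spans `X ⟵σ X'' ⟶g Y`** with `σ` birational and `g` onto, all three
smooth projective `n`-folds, `k + q = 2n`, `k ≥ 1`: heart at `X` ⟹ heart at `X''` (birational
invariance, `genericDivisibilityBounded_levelClean_iff_of_isBirational`) ⟹ heart at `Y`
(`genericDivisibilityBounded_heart_of_surjective`). E.g. from an abelian `2p`-fold `A` to every smooth
projective model of `A/G` for EVERY finite group `G`, and along every generically finite dominant
rational map. [cite: Fulton1998, Lemma 19.1.2] [cite: VoisinHodgeI2002, §7.3.2 Lemma 7.28] -/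
theorem genericDivisibilityBounded_heart_of_span {n : ℕ} {X X'' Y : SchemeOver ℂ} (σ : X'' ⟶ X)
    (g : X'' ⟶ Y) (hX : IsSmoothProjective n X) (hX'' : IsSmoothProjective n X'')
    (hY : IsSmoothProjective n Y) (hσ : Literature.AlgebraicGeometry.Resolution.IsBirational σ.left)
    (hg : Function.Surjective g.left.base) {k q : ℕ} (hkq : k + q = 2 * n) (hk : 1 ≤ k) {ℓ : ℕ}
    (hℓ : ℓ.Prime)
    (hC : ∃ s : ℕ, 1 ≤ s ∧ ∀ z : singularCohomology ℤ ℤ (ComplexPoints X) k,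
      (∃ Z : Set X.left, IsClosed Z ∧ Z ≠ Set.univ ∧
        ∃ (y : singularCohomology ℤ ℤ (complexPointsCompl X Z) k) (M : ℕ), 1 ≤ M ∧
          M • (Res[X, Z, k] z - ℓ ^ s • y) = 0) →
      ∃ w : singularCohomology ℤ ℤ (ComplexPoints X) k, ∃ Z : Set X.left, IsClosed Z ∧
        Z ≠ Set.univ ∧ ∃ N : ℕ, 1 ≤ N ∧ N • Res[X, Z, k] (z - ℓ • w) = 0) :
    ∃ s : ℕ, 1 ≤ s ∧ ∀ y₀ : singularCohomology ℤ ℤ (ComplexPoints Y) k,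
      (∃ Z : Set Y.left, IsClosed Z ∧ Z ≠ Set.univ ∧
        ∃ (y : singularCohomology ℤ ℤ (complexPointsCompl Y Z) k) (M : ℕ), 1 ≤ M ∧
          M • (Res[Y, Z, k] y₀ - ℓ ^ s • y) = 0) →
      ∃ w : singularCohomology ℤ ℤ (ComplexPoints Y) k, ∃ Z : Set Y.left, IsClosed Z ∧
        Z ≠ Set.univ ∧ ∃ N : ℕ, 1 ≤ N ∧ N • Res[Y, Z, k] (y₀ - ℓ • w) = 0 :=
  genericDivisibilityBounded_heart_of_surjective g hX'' hY hg hkq hk hℓ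
    (hC.imp fun s hs ↦ ⟨hs.1,
      (genericDivisibilityBounded_levelClean_iff_of_isBirational hX'' hX σ hσ hk hkq ℓ s).2 hs.2⟩)

/-! ### Function-field invariance: clean levels, C2 at `X`, and the `N¹ = ⊤` locus -/

/-- **A clean level is an invariant of the function field.** For two projective models `M₁`, `M₂` of
one field `K/ℂ` whose varieties are smooth projective `n`-folds, `k + q = 2n`, `k ≥ 1`, and any
`ℓ`, `s`: level `ℓ^s` is clean at `M₁` in degree `k` iff it is clean at `M₂` (common smooth projective
birational roof `stub_smoothRoofOfProjModels`, and the two-sided birational invariance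
`genericDivisibilityBounded_levelClean_iff_of_isBirational`). In particular the HEART at `ℓ` depends
only on `ℂ(X)`. [cite: ZariskiSamuel1960, Ch. VI §17] [cite: Kollar2007, Thm. 3.27] -/
theorem genericDivisibilityBounded_levelClean_iff_of_projModels {K : Type} [Field K] [Algebra ℂ K]
    (M₁ M₂ : Literature.AlgebraicGeometry.Resolution.ProjModel ℂ K) {n : ℕ}
    (h₁ : IsSmoothProjective n M₁.toOver) (h₂ : IsSmoothProjective n M₂.toOver) {k q : ℕ}
    (hkq : k + q = 2 * n) (hk : 1 ≤ k) (ℓ s : ℕ) :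
    (∀ z : singularCohomology ℤ ℤ (ComplexPoints M₁.toOver) k,
      (∃ Z : Set M₁.toOver.left, IsClosed Z ∧ Z ≠ Set.univ ∧
        ∃ (y : singularCohomology ℤ ℤ (complexPointsCompl M₁.toOver Z) k) (M : ℕ), 1 ≤ M ∧
          M • (Res[M₁.toOver, Z, k] z - ℓ ^ s • y) = 0) →
      ∃ w : singularCohomology ℤ ℤ (ComplexPoints M₁.toOver) k, ∃ Z : Set M₁.toOver.left,
        IsClosed Z ∧ Z ≠ Set.univ ∧ ∃ N : ℕ, 1 ≤ N ∧ N • Res[M₁.toOver, Z, k] (z - ℓ • w) = 0) ↔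
    (∀ z : singularCohomology ℤ ℤ (ComplexPoints M₂.toOver) k,
      (∃ Z : Set M₂.toOver.left, IsClosed Z ∧ Z ≠ Set.univ ∧
        ∃ (y : singularCohomology ℤ ℤ (complexPointsCompl M₂.toOver Z) k) (M : ℕ), 1 ≤ M ∧
          M • (Res[M₂.toOver, Z, k] z - ℓ ^ s • y) = 0) →
      ∃ w : singularCohomology ℤ ℤ (ComplexPoints M₂.toOver) k, ∃ Z : Set M₂.toOver.left,
        IsClosed Z ∧ Z ≠ Set.univ ∧ ∃ N : ℕ, 1 ≤ N ∧ N • Res[M₂.toOver, Z, k] (z - ℓ • w) = 0) := by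
  obtain ⟨Y, σ₁, σ₂, hY, hσ₁, hσ₂⟩ := stub_smoothRoofOfProjModels K M₁ M₂ n h₁ h₂
  exact (genericDivisibilityBounded_levelClean_iff_of_isBirational hY h₁ σ₁ hσ₁ hk hkq ℓ s).symm.trans
    (genericDivisibilityBounded_levelClean_iff_of_isBirational hY h₂ σ₂ hσ₂ hk hkq ℓ s)

/-- **C2 at `X` is an invariant of the function field.** For two projective models `M₁`, `M₂` of one
field `K/ℂ` whose varieties are smooth projective `n`-folds, `k + q = 2n`, `k ≥ 1`: C2 holds at `M₁`
in degree `k` iff it holds at `M₂` (roof, then C2 descends along surjections —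
`genericDivisibilityBounded_at_of_isBirational`, p160936 — and ascends along birational morphisms —
`genericDivisibilityBounded_at_of_isBirational_up`, p162489). [cite: ZariskiSamuel1960, Ch. VI §17]
[cite: ColliotTheleneVoisin2012, Thm. 2.8 (iii)] -/
theorem genericDivisibilityBounded_at_iff_of_projModels {K : Type} [Field K] [Algebra ℂ K]
    (M₁ M₂ : Literature.AlgebraicGeometry.Resolution.ProjModel ℂ K) {n : ℕ}
    (h₁ : IsSmoothProjective n M₁.toOver) (h₂ : IsSmoothProjective n M₂.toOver) {k q : ℕ}
    (hkq : k + q = 2 * n) (hk : 1 ≤ k) :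
    (∀ z : singularCohomology ℤ ℤ (ComplexPoints M₁.toOver) k,
      (∀ m : ℕ, 1 ≤ m → ∃ Z : Set M₁.toOver.left, IsClosed Z ∧ Z ≠ Set.univ ∧
        ∃ y : singularCohomology ℤ ℤ (complexPointsCompl M₁.toOver Z) k,
          m • y = Res[M₁.toOver, Z, k] z) →
      singularCohomology.ringChange (Int.castRingHom ℂ) (ComplexPoints M₁.toOver) k z ∈
        supportedClasses M₁.toOver k 1) ↔
    (∀ z : singularCohomology ℤ ℤ (ComplexPoints M₂.toOver) k,
      (∀ m : ℕ, 1 ≤ m → ∃ Z : Set M₂.toOver.left, IsClosed Z ∧ Z ≠ Set.univ ∧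
        ∃ y : singularCohomology ℤ ℤ (complexPointsCompl M₂.toOver Z) k,
          m • y = Res[M₂.toOver, Z, k] z) →
      singularCohomology.ringChange (Int.castRingHom ℂ) (ComplexPoints M₂.toOver) k z ∈
        supportedClasses M₂.toOver k 1) := by
  obtain ⟨Y, σ₁, σ₂, hY, hσ₁, hσ₂⟩ := stub_smoothRoofOfProjModels K M₁ M₂ n h₁ h₂
  exact ⟨fun hC z hz ↦ genericDivisibilityBounded_at_of_isBirational σ₂ hY h₂ hσ₂ k
      (genericDivisibilityBounded_at_of_isBirational_up hY h₁ σ₁ hσ₁ hk hkq hC) z hz,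
    fun hC z hz ↦ genericDivisibilityBounded_at_of_isBirational σ₁ hY h₁ hσ₁ k
      (genericDivisibilityBounded_at_of_isBirational_up hY h₂ σ₂ hσ₂ hk hkq hC) z hz⟩

/-- **The `N¹ = ⊤` locus is an invariant of the function field.** For two projective models `M₁`, `M₂`
of one field `K/ℂ` whose varieties are smooth projective `n`-folds and `k + q = 2n`:
`N¹Hᵏ(M₁(ℂ);ℂ) = Hᵏ` iff `N¹Hᵏ(M₂(ℂ);ℂ) = Hᵏ` (roof and
`genericDivisibilityBounded_supportedClasses_eq_top_iff_of_isBirational`, p167882). So the OPEN LOCUS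
of the heart and of C2 (`supportedClasses X (2p) 1 ≠ ⊤`, p162249) depends only on `ℂ(X)`.
[cite: ZariskiSamuel1960, Ch. VI §17] [cite: VoisinHodgeI2002, §7.3.2 Lemma 7.28] -/
theorem genericDivisibilityBounded_supportedClasses_eq_top_iff_of_projModels {K : Type} [Field K]
    [Algebra ℂ K] (M₁ M₂ : Literature.AlgebraicGeometry.Resolution.ProjModel ℂ K) {n : ℕ}
    (h₁ : IsSmoothProjective n M₁.toOver) (h₂ : IsSmoothProjective n M₂.toOver) {k q : ℕ}
    (hkq : k + q = 2 * n) :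
    supportedClasses M₁.toOver k 1 = ⊤ ↔ supportedClasses M₂.toOver k 1 = ⊤ := by
  obtain ⟨Y, σ₁, σ₂, hY, hσ₁, hσ₂⟩ := stub_smoothRoofOfProjModels K M₁ M₂ n h₁ h₂
  exact (genericDivisibilityBounded_supportedClasses_eq_top_iff_of_isBirational hY h₁ σ₁ hσ₁ hkq).symm.trans
    (genericDivisibilityBounded_supportedClasses_eq_top_iff_of_isBirational hY h₂ σ₂ hσ₂ hkq)

/-! ### The SNC normal form of the heart, as an equivalence -/

/-- An SNC witness set `⋃_{D ∈ E} supp D` is Zariski closed (finite union of supports). [folklore] -/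
theorem genericDivisibilityBounded_isClosed_biUnion_support {X' : SchemeOver ℂ}
    (E : List X'.left.IdealSheafData) : IsClosed (⋃ D ∈ E, ((D.support : Set X'.left))) :=
  Set.Finite.isClosed_biUnion (s := {D | D ∈ E}) (List.finite_toSet E) fun D _ ↦ D.support.isClosed

/-- **The SNC normal form of the heart, unconditionally, as an equivalence.** Level `ℓ^s` is clean at
the smooth projective `2p`-fold `X` (`p ≥ 1`) iff on every smooth projective birational model
`σ : X' ⟶ X` and for every simple-normal-crossing boundary `E` on `X'` with `⋃ supp E ≠ X'` the classes
`z'` with `D'_{⋃ supp E}(ℓ^s, z')` satisfy the clean-level conclusion (→: a clean level is a birational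
invariant, `genericDivisibilityBounded_levelClean_iff_of_isBirational`, and `⋃ supp E` is a closed
witness set; ←: `stub_levelCleanOfSNCWitnessesUnconditional` — log resolution of the witness, Kollár
Thm. 3.21, proved in the tree, then pull back / SNC hypothesis / push forward by the degree-one Gysin
map). [cite: Kollar2007, Thm. 3.21] [cite: Fulton1998, Lemma 19.1.2] -/
theorem genericDivisibilityBounded_levelClean_iff_SNCWitnesses {p : ℕ} {X : SchemeOver ℂ} (hp : 1 ≤ p)
    (hX : IsSmoothProjective (2 * p) X) (ℓ s : ℕ) :
    (∀ z : singularCohomology ℤ ℤ (ComplexPoints X) (2 * p),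
      (∃ Z : Set X.left, IsClosed Z ∧ Z ≠ Set.univ ∧
        ∃ (y : singularCohomology ℤ ℤ (complexPointsCompl X Z) (2 * p)) (M : ℕ), 1 ≤ M ∧
          M • (Res[X, Z, 2 * p] z - ℓ ^ s • y) = 0) →
      ∃ w : singularCohomology ℤ ℤ (ComplexPoints X) (2 * p), ∃ Z : Set X.left, IsClosed Z ∧
        Z ≠ Set.univ ∧ ∃ N : ℕ, 1 ≤ N ∧ N • Res[X, Z, 2 * p] (z - ℓ • w) = 0) ↔
    ∀ (X' : SchemeOver ℂ) (σ : X' ⟶ X) (E : List X'.left.IdealSheafData),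
      IsSmoothProjective (2 * p) X' → Literature.AlgebraicGeometry.Resolution.IsBirational σ.left →
      Literature.AlgebraicGeometry.Resolution.HasSNC E →
      (⋃ D ∈ E, ((D.support : Set X'.left))) ≠ Set.univ →
      ∀ z' : singularCohomology ℤ ℤ (ComplexPoints X') (2 * p),
        (∃ (y : singularCohomology ℤ ℤ
              (complexPointsCompl X' (⋃ D ∈ E, ((D.support : Set X'.left)))) (2 * p)) (M : ℕ),
            1 ≤ M ∧ M • (Res[X', ⋃ D ∈ E, ((D.support : Set X'.left)), 2 * p] z' - ℓ ^ s • y) = 0) →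
        ∃ w : singularCohomology ℤ ℤ (ComplexPoints X') (2 * p), ∃ Z' : Set X'.left, IsClosed Z' ∧
          Z' ≠ Set.univ ∧ ∃ N : ℕ, 1 ≤ N ∧ N • Res[X', Z', 2 * p] (z' - ℓ • w) = 0 :=
  ⟨fun hC _ σ E hX' hσ _ hne z' hz' ↦
      (genericDivisibilityBounded_levelClean_iff_of_isBirational hX' hX σ hσ (k := 2 * p) (q := 2 * p)
        (by omega) (by omega) ℓ s).2 hC z'
        ⟨_, genericDivisibilityBounded_isClosed_biUnion_support E, hne, hz'⟩,
    fun h z hz ↦ stub_levelCleanOfSNCWitnessesUnconditional hp hX ℓ s h z hz⟩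

end Summit.HodgeConjecture.HodgeConjecture.Theorems

end
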